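import Literature.Barriers.AnomalousDissipation.ObukhovCorrsinThresholdProofs
import HarnessLib

/-!
# The Obukhov–Corrsin threshold, time-integrated corner: `L^∞_t C^{0,α}` velocities against
`L²_t C^{0,β}` scalars (barrier audit 2026-08-17, gen 14)

Barrier-audit addendum (D-0021) to the named fact
`Literature.Barriers.AnomalousDissipation.DrivasElgindiIyerJeong2022_thm4`
(`Barriers/AnomalousDissipation/ObukhovCorrsinThreshold`), scope caveat (i) ("TIME EXPONENTS"),
which records ON PAPER that the Constantin–E–Titi argument of Drivas–Elgindi–Iyer–Jeong 2022,
Thm. 4, gives no anomalous scalar dissipation whenever the velocity is bounded in `L^p_t C^α_x` and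
the scalars in `L^{p°}_t C^β_x` with `1/p + 2/p° ≤ 1` and `β > (1-α)/2` — the vendored fact being the
corner `(p, p°) = (1, ∞)`. This file makes the opposite corner `(p, p°) = (∞, 2)` a theorem: it is
the corner at which the flexible side is in print for EVERY velocity exponent `α ∈ (0,1)`
(Elgindi–Liss 2024, Thm. 2: a field `u ∈ C([0,T]; C^α(T²))` dissipating anomalously every smooth
mean-zero datum with `sup_κ ‖θ^κ‖_{L²(0,T;C^β)} < ∞`, any `β < (1-α)/2`), whereas its rigid
counterpart — "if `u ∈ L^∞([0,T];C^α)` … and `{f^κ}` remain uniformly bounded in `L²([0,T];C^β)`,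
then … `limsup_{κ→0} κ∫₀ᵀ‖∇f^κ‖² = 0` unless `β ≤ (1-α)/2` … can be proven in a similar fashion to
the rigidity side of Onsager's conjecture (see [DEIJ22])" (Elgindi–Liss 2024, (1.4)) — was stated
in print without proof. With this file the Obukhov–Corrsin line is two-sidedly sharp, theorem
against print, at the corner `(∞, 2)` for all `α ∈ (0,1)`; at the time-uniform corner it is so only
for `α < 1/3` (Burczak–Székelyhidi–Wu 2026, Thm. 1.1; `ObukhovCorrsinThreshold`, gen-3 audit).

* `two_mul_eScalarDissipation_le_timeIntegrated` — the fixed-scale bound (5.10) with the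
  time pairing moved: for a divergence-free field of the weak-solution class with
  `ess sup_{t∈(0,T)} ‖u(t)‖_{C^{0,α}} ≤ K` (an a.e. bound on the slices), a datum with
  `‖θ₀‖_{C^{0,β}} ≤ M₀`, and a weak solution `θ` of `∂ₜθ + u·∇θ = κΔθ` obeying the energy balance
  whose slices lie in `C^{0,β}` for a.e. `t` with `‖θ‖_{L²(0,T;C^{0,β})} ≤ M`
  (`eLpHolderNorm 2 β θ (Ioo 0 T) ≤ M`, the tree's `L^p_t C^{0,β}_x` norm at `p = 2`),
  `2κ∫₀ᵀ‖∇θ‖² ≤ M₀²ε^{2β} + 4dC₁KM² ε^{α+2β-1} + 2dC₁²M² κε^{2β-2}` — the window length `T` no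
  longer appears, having been absorbed into `M² = ∫₀ᵀ‖θ(t)‖²_{C^{0,β}} dt`;
* `DrivasElgindiIyerJeong2022_thm4_timeIntegrated` — the optimised bound in the quantifier shape
  of the named fact: `κ∫₀ᵀ‖∇θ‖² ≤ C κ^{(α+2β-1)/(α+1)}`, `C = C(d, α, β, K, M₀, M, κ₀)` explicit;
* `DrivasElgindiIyerJeong2022_thm4_timeIntegrated.noAnomalousScalarDissipation` — the family
  corollary (`α + 2β > 1`, `κ_j → 0`, `j`-dependent fields, data and scalars with the same three
  bounds: dissipation `→ 0`).

THE DATUM CLAUSE (what the time-integrated reading of caveat (i) needs at family level). In the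
time-uniform class of the named fact the datum bound is implied by the solution bound (Hölder
balls are weakly closed and weak solutions are weakly continuous at `t = 0`); in a time-INTEGRATED
class it is not, and it is load-bearing: the datum enters (5.9) through the unresolved variance
`½(‖θ₀‖²₂ - ‖θ₀ ⋆ k_ε‖²₂) ≤ ½[θ₀]²_β ε^{2β}`, which no bound on `∫₀ᵀ‖θ(t)‖²_{C^β}dt` controls.
Indeed already for `u ≡ 0` (so `u` is bounded in every `L^p_t C^{0,α}`, `α ≤ 1`, and the threshold
is `β > 0`): the heat flows `θ_j(t,x) = e^{-4π²N_j²κ_jt} sin(2πN_jx₁)` from the data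
`θ₀,ⱼ = sin(2πN_jx₁)` (`‖θ₀,ⱼ‖_{L²} = 2^{-1/2}`, `‖θ₀,ⱼ‖_∞ = 1`, `[θ₀,ⱼ]_β ≍ N_j^β → ∞`) with
`κ_j := N_j^{2β-2} → 0` (`β < 1`) satisfy `∫₀^∞ ‖θ_j(t)‖²_{C^{0,β}} dt ≤ (1 + 2π^βN_j^β)²/(8π²N_j^{2β})`,
bounded uniformly in `j`, while `κ_j∫₀ᵀ‖∇θ_j‖²₂ = ¼(1 - e^{-8π²N_j^{2β}T}) → ¼` on every window: a
family bounded in `L²_t C^{0,β}` (indeed in `L^{p°}_t C^{0,β}` for every `p° < 2/β`, with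
`κ_j = N_j^{βp°-2}`) dissipating a quarter of its variance in the initial layer `t ≲ N_j^{-2β}`.
So the rigid region `{1/p + 2/p° ≤ 1, α + 2β > 1}` of caveat (i) is a statement about ONE datum
(the print's `θ^κ`, [cite: ElgindiLiss2024, (1.4)], [cite: ColomboCrippaSorella2023, §1]) or about
families whose data are bounded in `C^{0,β}` (this file; `B^β_{2,∞}` suffices, as in the
Nikol'skii corner) — for `p° < ∞` it is false for families with `j`-dependent rough data, the
anomaly then being the trivial dissipation of unresolved initial variance. For the long-time
(`limsup`-mean) readings of the block (caveats (ii), (ix), (x)) nothing changes: there the datum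
term `½‖θ(t₀)‖²₂` is free per unit time.

OTHER TIME EXPONENTS. On a window `‖θ‖_{L²_tC^{0,β}} ≤ T^{1/2-1/p°}‖θ‖_{L^{p°}_tC^{0,β}}`, so the
corners `(∞, p°)`, `p° ≥ 2`, follow; the corners with `p < ∞` (`∫₀ᵀ[u]_α[θ]²_β ≤
‖[u]_α‖_{L^p_t}‖[θ]_β‖²_{L^{2p'}_t}`, Hölder in time) stay on paper — for them the lower
integrals used here do not suffice and measurability of `t ↦ ‖u(t)‖_{C^{0,α}}`,
`t ↦ ‖θ(t)‖_{C^{0,β}}` must be assumed (Hölder's inequality fails for lower integrals of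
non-measurable functions).

## Proof

Verbatim the proof of `DrivasElgindiIyerJeong2022_thm4.two_mul_eScalarDissipation_le`
(`ObukhovCorrsinThresholdProofs`: mollified energy identity with datum, the slice bound
`Torus.neg_integral_conv_mul_flux_le_of_holderWith` of `PassiveScalarHolderSlice`, the cumulant
bound, `setLIntegral_Ioo_le_of_ae_le`, `scale_bound`), except that the slice bound is kept in the
form `‖θ(s)‖²_{C^{0,β}} (2dC₁ε^{α+2β-1}[u(s)]_α + κdC₁²ε^{2β-2})`, the velocity factor is bounded
by `K` for a.e. `s`, and the time integral of `‖θ(s)‖²_{C^{0,β}}` is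
`(eLpHolderNorm 2 β θ (Ioo 0 T))² ≤ M²` (`PassiveScalarProofs.eLpNorm_two_pow_two`; a lower
integral, so that no measurability of `s ↦ ‖θ(s)‖_{C^{0,β}}` is needed).

## Mathlib / tree search

Tree: `ObukhovCorrsinThresholdProofs` (the `(1,∞)` corner and the two elementary lemmas reused
here), `ObukhovCorrsinThresholdNikolskii`/`Besov`/`SobolevVelocity`/`L1Velocity` (the spatial
corners), `HolderNorm` (`eLpHolderNorm`, `MemLpHolder`, `MemBoundedHolder`); no time-integrated
scalar corner. Mathlib: `ENNReal.lintegral_mul_le_Lp_mul_Lq` (Hölder, needs `AEMeasurable`) — not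
used. Literature: the `(∞,2)` rigid statement is asserted without proof in
[cite: ElgindiLiss2024, (1.4)] and, for general `(p,p°)`, in [cite: ColomboCrippaSorella2023, §1];
flexible side at `(∞,2)`: [cite: ElgindiLiss2024, Thm. 2]; at `p° ∈ [2,4]`:
[cite: ColomboCrippaSorella2023, Thm. 1].

## References

* T. D. Drivas, T. M. Elgindi, G. Iyer, I.-J. Jeong, Arch. Ration. Mech. Anal. 243 (2022)
  1151–1180, Thm. 4 and its proof, §5, (5.8)–(5.10) (arXiv:1911.03271, pp. 17–18). Bib key
  `DrivasEtAl2022`.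
* T. M. Elgindi, K. Liss, Arch. Ration. Mech. Anal. 248 (2024), (1.4) and Thm. 2
  (arXiv:2309.08576, p. 4). Bib key `ElgindiLiss2024`.
* M. Colombo, G. Crippa, M. Sorella, Ann. PDE 9 (2023), Paper No. 21, §1, (1) and Thm. 1
  (arXiv:2207.06833). Bib key `ColomboCrippaSorella2023`.
* P. Constantin, W. E, E. S. Titi, Comm. Math. Phys. 165 (1994), 207–209, (6)–(11). Bib key
  `ConstantinETiti1994`.
-/

open MeasureTheory Set Filter Topology
open scoped ENNReal NNReal Convolution InnerProductSpace

noncomputable section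

namespace Literature.Barriers.AnomalousDissipation

open Literature.Analysis Literature.Analysis.FunctionSpaces Literature.Analysis.FluidPDE

/-! ## The dissipation bound at a fixed mollification scale, time-integrated corner -/

/-- **The bound (5.10) at fixed scale, `(p,p°) = (∞,2)` corner** (barrier audit 2026-08-17,
gen 14). For a field of the weak-solution class with `‖u(t)‖_{C^{0,α}} ≤ K` for a.e.
`t ∈ (0,T)`, a datum with `‖θ₀‖_{C^{0,β}} ≤ M₀`, `κ > 0`, a weak solution `θ` of
`∂ₜθ + u·∇θ = κΔθ`, `θ(0) = θ₀` on `T^d × [0,T)` obeying the energy balance, with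
`θ(t) ∈ C^{0,β}` for a.e. `t` and `‖θ‖_{L²(0,T;C^{0,β})} ≤ M` (`eLpHolderNorm 2 β θ (Ioo 0 T) ≤ M`),
and a mollification scale `0 < ε ≤ 1/4`:
`2κ ∫₀ᵀ ‖∇θ‖²_{L²} ≤ M₀² ε^{2β} + 2 (2 d C₁ M² ε^{α+2β-1} K + κ d C₁² M² ε^{2β-2})`,
`C₁ = Torus.gradProfileMass d`, `d = card d` — the bound of
`DrivasElgindiIyerJeong2022_thm4.two_mul_eScalarDissipation_le` with `T M²` and `K M²` replaced by
`M² = ‖θ‖²_{L²_tC^{0,β}}` times the `L^∞_t` velocity bound. [cite: DrivasEtAl2022, proof of Thm. 4, (5.9)–(5.10)]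
[cite: ElgindiLiss2024, (1.4)] -/
theorem two_mul_eScalarDissipation_le_timeIntegrated {d : Type*} [Fintype d]
    [DecidableEq d] {T : ℝ} (hT : 0 < T) {α β : ℝ≥0} (hβ : 0 < β) {K M₀ M : ℝ≥0}
    {u : ℝ → UnitAddTorus d → EuclideanSpace ℝ d}
    (huK : ∀ᵐ t ∂((volume : Measure ℝ).restrict (Ioo 0 T)), eBoundedHolderNorm α (u t) ≤ K)
    {θ₀ : UnitAddTorus d → ℝ} (hθ₀ : eBoundedHolderNorm β θ₀ ≤ M₀) {κ : ℝ} (hκ : 0 < κ)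
    {θ : ℝ → UnitAddTorus d → ℝ} (hθ : Torus.IsWeakScalarTransportOn T κ u θ₀ θ)
    (henergy : ∀ᵐ t ∂((volume : Measure ℝ).restrict (Ioo 0 T)),
      (∫⁻ x, ‖θ t x‖ₑ ^ 2) + 2 * Torus.eScalarDissipation κ θ 0 t ≤ ∫⁻ x, ‖θ₀ x‖ₑ ^ 2)
    (hθB : ∀ᵐ t ∂((volume : Measure ℝ).restrict (Ioo 0 T)), MemBoundedHolder β (θ t))
    (hθM : eLpHolderNorm 2 β θ (Ioo 0 T) ≤ M)
    {ε : ℝ} (hε : 0 < ε) (hε' : ε ≤ 1 / 4) :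
    2 * Torus.eScalarDissipation κ θ 0 T ≤ ENNReal.ofReal
      ((M₀ : ℝ) ^ 2 * ε ^ (2 * (β : ℝ)) +
        2 * ((2 * Fintype.card d * Torus.gradProfileMass d * (M : ℝ) ^ 2 * ε ^ ((α : ℝ) + 2 * β - 1)) * K +
          κ * (Fintype.card d * (Torus.gradProfileMass d ^ 2 * (M : ℝ) ^ 2 * ε ^ (2 * (β : ℝ) - 2))))) := by
  -- the datum
  have hM₀top : ((M₀ : ℝ≥0∞)) < ⊤ := ENNReal.coe_lt_top
  have hθ₀B : MemBoundedHolder β θ₀ := lt_of_le_of_lt hθ₀ hM₀top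
  have hθ₀H : HolderWith M₀ β θ₀ := by
    refine Torus.holderWith_of_nnHolderNorm_le hθ₀B.memHolder (ENNReal.coe_le_coe.1 ?_)
    rw [hθ₀B.memHolder.coe_nnHolderNorm_eq_eHolderNorm]
    exact (eHolderNorm_le_eBoundedHolderNorm β θ₀).trans hθ₀
  have hθ₀c : Continuous θ₀ := hθ₀B.continuous hβ
  have hθ₀i : Integrable θ₀ volume := hθ₀c.integrable_unitAddTorus
  set k : UnitAddTorus d → ℝ := Torus.kernel ε with hk_def
  have hk : Torus.IsSmooth k := Torus.isSmooth_kernel hε hε'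
  -- constants and exponent bookkeeping
  set C₁ : ℝ := Torus.gradProfileMass d with hC₁
  have hC₁0 : 0 ≤ C₁ := Torus.gradProfileMass_nonneg
  set a₁ : ℝ := 2 * Fintype.card d * C₁ * ε ^ ((α : ℝ) + 2 * β - 1) * K with ha₁
  set a₂ : ℝ := κ * (Fintype.card d * (C₁ ^ 2 * ε ^ (2 * (β : ℝ) - 2))) with ha₂
  have ha₁0 : 0 ≤ a₁ := by positivity
  have ha₂0 : 0 ≤ a₂ := by positivity
  have i1 : ((M₀ : ℝ) * ε ^ (β : ℝ)) ^ 2 = (M₀ : ℝ) ^ 2 * ε ^ (2 * (β : ℝ)) := by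
    rw [mul_pow, ← Real.rpow_natCast (ε ^ (β : ℝ)) 2, ← Real.rpow_mul hε.le]
    congr 2
    push_cast
    ring
  have i2 : ε⁻¹ * ε ^ (β : ℝ) * ε ^ (α : ℝ) * ε ^ (β : ℝ) = ε ^ ((α : ℝ) + 2 * β - 1) := by
    rw [← Real.rpow_neg_one ε, ← Real.rpow_add hε, ← Real.rpow_add hε, ← Real.rpow_add hε]
    congr 1
    ring
  have i3 : (ε⁻¹ * ε ^ (β : ℝ)) ^ 2 = ε ^ (2 * (β : ℝ) - 2) := by
    rw [← Real.rpow_neg_one ε, ← Real.rpow_add hε, ← Real.rpow_natCast _ 2, ← Real.rpow_mul hε.le]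
    congr 1
    push_cast
    ring
  -- Step 1: the slice bound, for a.e. `s`, with the scalar norm of the slice kept
  have hslice : ∀ᵐ s ∂((volume : Measure ℝ).restrict (Ioo 0 T)),
      -(∫ x, ((θ s) ⋆ k) x * ∫ y, θ s y *
        (-⟪u s y, Torus.gradient k (x - y)⟫_ℝ + κ * Torus.laplacian k (x - y))) ≤
        boundedHolderNorm β (θ s) ^ 2 * (a₁ + a₂) := by
    filter_upwards [hθB, huK, hθ.ae_isWeaklyDivFree, hθ.ae_aestronglyMeasurable_velocity_slice]
      with s hsB hsuK hdiv hum
    -- the scalar slice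
    have hθsH : HolderWith (nnHolderNorm β (θ s)) β (θ s) := hsB.memHolder.holderWith
    have hθsc : Continuous (θ s) := hsB.continuous hβ
    have hb : ((nnHolderNorm β (θ s) : ℝ≥0) : ℝ) ≤ boundedHolderNorm β (θ s) :=
      ENNReal.toReal_mono hsB.ne (eHolderNorm_le_eBoundedHolderNorm β (θ s))
    -- the velocity slice
    have hsu : MemBoundedHolder α (u s) := lt_of_le_of_lt hsuK ENNReal.coe_lt_top
    have huH : HolderWith (nnHolderNorm α (u s)) α (u s) := hsu.memHolder.holderWith
    have hCv : ∀ y, ‖u s y‖ ≤ (eSupNorm (u s)).toReal := fun y => by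
      rw [← toReal_enorm]
      exact ENNReal.toReal_mono hsu.eSupNorm_lt_top.ne (enorm_le_eSupNorm (u s) y)
    have huKle : ((nnHolderNorm α (u s) : ℝ≥0) : ℝ) ≤ K := by
      have h1 : ((nnHolderNorm α (u s) : ℝ≥0) : ℝ≥0∞) ≤ K := by
        rw [hsu.memHolder.coe_nnHolderNorm_eq_eHolderNorm]
        exact (eHolderNorm_le_eBoundedHolderNorm α (u s)).trans hsuK
      exact_mod_cast h1
    have h := Torus.neg_integral_conv_mul_flux_le_of_holderWith hθsc hθsH hum hCv huH hdiv hε hε' hκ.le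
    have hn0 : 0 ≤ ((nnHolderNorm α (u s) : ℝ≥0) : ℝ) := NNReal.coe_nonneg _
    have hb0 : 0 ≤ ((nnHolderNorm β (θ s) : ℝ≥0) : ℝ) := NNReal.coe_nonneg _
    have hpow : ((nnHolderNorm β (θ s) : ℝ≥0) : ℝ) ^ 2 ≤ boundedHolderNorm β (θ s) ^ 2 :=
      pow_le_pow_left₀ hb0 hb 2
    have hin : 2 * Fintype.card d * C₁ * ε ^ ((α : ℝ) + 2 * β - 1) * ((nnHolderNorm α (u s) : ℝ≥0) : ℝ) + a₂ ≤
        a₁ + a₂ := by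
      rw [ha₁]
      gcongr
    have hin0 : 0 ≤ 2 * Fintype.card d * C₁ * ε ^ ((α : ℝ) + 2 * β - 1) * ((nnHolderNorm α (u s) : ℝ≥0) : ℝ) + a₂ := by
      positivity
    calc _ ≤ _ := h
      _ = ((nnHolderNorm β (θ s) : ℝ≥0) : ℝ) ^ 2 *
            (2 * Fintype.card d * C₁ * ε ^ ((α : ℝ) + 2 * β - 1) * ((nnHolderNorm α (u s) : ℝ≥0) : ℝ) + a₂) := by
          rw [ha₂, ← i2, ← i3]
          ring
      _ ≤ boundedHolderNorm β (θ s) ^ 2 * (a₁ + a₂) := mul_le_mul hpow hin hin0 (sq_nonneg _)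
  -- Step 2: the time integral of the slice bound, in `ℝ≥0∞`
  have hM2 : ∫⁻ s in Ioo 0 T, ENNReal.ofReal (boundedHolderNorm β (θ s) ^ 2) ≤ (M : ℝ≥0∞) ^ 2 := by
    have e : ∫⁻ s in Ioo 0 T, ENNReal.ofReal (boundedHolderNorm β (θ s) ^ 2) =
        eLpHolderNorm 2 β θ (Ioo 0 T) ^ 2 := by
      rw [eLpHolderNorm, PassiveScalarProofs.eLpNorm_two_pow_two]
      refine lintegral_congr fun s => ?_
      have h0 : 0 ≤ boundedHolderNorm β (θ s) := ENNReal.toReal_nonneg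
      rw [ENNReal.ofReal_pow h0, Real.enorm_eq_ofReal h0]
    rw [e]
    gcongr
  have htime : ∀ t ∈ Ioo 0 T,
      ENNReal.ofReal (∫ s in Ioc 0 t, -(∫ x, ((θ s) ⋆ k) x * ∫ y, θ s y *
        (-⟪u s y, Torus.gradient k (x - y)⟫_ℝ + κ * Torus.laplacian k (x - y)))) ≤
        (M : ℝ≥0∞) ^ 2 * ENNReal.ofReal (a₁ + a₂) := by
    intro t ht
    refine (ofReal_integral_le_lintegral_ofReal _).trans ?_
    refine (lintegral_mono_set (Ioc_subset_Ioo_right ht.2)).trans ?_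
    have hmono : ∫⁻ s in Ioo 0 T, ENNReal.ofReal (-(∫ x, ((θ s) ⋆ k) x * ∫ y, θ s y *
        (-⟪u s y, Torus.gradient k (x - y)⟫_ℝ + κ * Torus.laplacian k (x - y)))) ≤
        ∫⁻ s in Ioo 0 T, ENNReal.ofReal (boundedHolderNorm β (θ s) ^ 2) * ENNReal.ofReal (a₁ + a₂) := by
      refine lintegral_mono_ae (hslice.mono fun s hs => ?_)
      rw [← ENNReal.ofReal_mul (sq_nonneg _)]
      exact ENNReal.ofReal_le_ofReal hs
    refine hmono.trans ?_
    rw [lintegral_mul_const' _ _ ENNReal.ofReal_ne_top]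
    gcongr
  -- Step 3: the bound for a.e. `t`
  have hmain : ∀ᵐ t ∂((volume : Measure ℝ).restrict (Ioo 0 T)), 2 * Torus.eScalarDissipation κ θ 0 t ≤
      ENNReal.ofReal ((M₀ : ℝ) ^ 2 * ε ^ (2 * (β : ℝ))) + 2 * ((M : ℝ≥0∞) ^ 2 * ENNReal.ofReal (a₁ + a₂)) := by
    filter_upwards [henergy, hθ.ae_integral_sq_molInt_eq hθ₀i hk, ae_restrict_mem measurableSet_Ioo,
      hθ.ae_slice_integrable₁] with t hen hid htT hint
    have hθti : Integrable (θ t) volume := hint.1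
    have hAc : Continuous ((θ t) ⋆ k) := Torus.continuous_convolution hθti hk.continuous
    -- Young: `‖θ(t) ⋆ k‖₂ ≤ ‖θ(t)‖₂`
    have hY : ∫⁻ x, ‖((θ t) ⋆ k) x‖ₑ ^ 2 ≤ ∫⁻ x, ‖θ t x‖ₑ ^ 2 := by
      rw [← PassiveScalarProofs.eLpNorm_two_pow_two, ← PassiveScalarProofs.eLpNorm_two_pow_two]
      gcongr
      calc eLpNorm ((θ t) ⋆ k) 2 volume ≤ (∫⁻ y, ‖k y‖ₑ) * eLpNorm (θ t) 2 volume :=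
            Torus.eLpNorm_convolution_le hθti.aestronglyMeasurable hk.continuous.aestronglyMeasurable one_le_two
        _ = eLpNorm (θ t) 2 volume := by rw [hk_def, Torus.lintegral_enorm_kernel hε hε', one_mul]
    have e0 : ∫⁻ x, ‖θ₀ x‖ₑ ^ 2 = ENNReal.ofReal (∫ x, θ₀ x ^ 2) :=
      Torus.lintegral_enorm_sq_eq_ofReal_integral_sq hθ₀c
    have eA : ∫⁻ x, ‖((θ t) ⋆ k) x‖ₑ ^ 2 = ENNReal.ofReal (∫ x, ((θ t) ⋆ k) x ^ 2) :=
      Torus.lintegral_enorm_sq_eq_ofReal_integral_sq hAc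
    have h1 : ENNReal.ofReal (∫ x, ((θ t) ⋆ k) x ^ 2) + 2 * Torus.eScalarDissipation κ θ 0 t ≤
        ENNReal.ofReal (∫ x, θ₀ x ^ 2) := by
      rw [← eA, ← e0]
      exact (add_le_add hY le_rfl).trans hen
    have h2 : 2 * Torus.eScalarDissipation κ θ 0 t ≤
        ENNReal.ofReal ((∫ x, θ₀ x ^ 2) - ∫ x, ((θ t) ⋆ k) x ^ 2) := by
      rw [ENNReal.ofReal_sub _ (integral_nonneg fun x => sq_nonneg _)]
      exact ENNReal.le_sub_of_add_le_left ENNReal.ofReal_ne_top h1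
    have h3 : (∫ x, θ₀ x ^ 2) - ∫ x, ((θ t) ⋆ k) x ^ 2 ≤ (M₀ : ℝ) ^ 2 * ε ^ (2 * (β : ℝ)) +
        2 * ∫ s in Ioc 0 t, -(∫ x, ((θ s) ⋆ k) x * ∫ y, θ s y *
          (-⟪u s y, Torus.gradient k (x - y)⟫_ℝ + κ * Torus.laplacian k (x - y))) := by
      rw [hid, integral_neg, ← i1]
      have := Torus.integral_sq_sub_integral_convolution_sq_le hθ₀c hθ₀H hε hε'
      linarith
    calc 2 * Torus.eScalarDissipation κ θ 0 t
        ≤ ENNReal.ofReal ((∫ x, θ₀ x ^ 2) - ∫ x, ((θ t) ⋆ k) x ^ 2) := h2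
      _ ≤ ENNReal.ofReal ((M₀ : ℝ) ^ 2 * ε ^ (2 * (β : ℝ)) +
          2 * ∫ s in Ioc 0 t, -(∫ x, ((θ s) ⋆ k) x * ∫ y, θ s y *
            (-⟪u s y, Torus.gradient k (x - y)⟫_ℝ + κ * Torus.laplacian k (x - y)))) :=
          ENNReal.ofReal_le_ofReal h3
      _ ≤ ENNReal.ofReal ((M₀ : ℝ) ^ 2 * ε ^ (2 * (β : ℝ))) +
          ENNReal.ofReal (2 * ∫ s in Ioc 0 t, -(∫ x, ((θ s) ⋆ k) x * ∫ y, θ s y *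
            (-⟪u s y, Torus.gradient k (x - y)⟫_ℝ + κ * Torus.laplacian k (x - y)))) :=
          ENNReal.ofReal_add_le
      _ ≤ _ := by
          rw [ENNReal.ofReal_mul zero_le_two, ENNReal.ofReal_ofNat]
          gcongr
          exact htime t htT
  -- Step 4: from a.e. `t` to `T`
  have h2D : ∀ t, 2 * Torus.eScalarDissipation κ θ 0 t =
      ∫⁻ s in Ioo 0 t, 2 * (ENNReal.ofReal κ * Torus.eScalarGradNormSq (θ s)) := fun t => by
    rw [Torus.eScalarDissipation, ← lintegral_const_mul' _ _ ENNReal.ofReal_ne_top,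
      ← lintegral_const_mul' _ _ ENNReal.ofNat_ne_top]
  have hfin : 2 * Torus.eScalarDissipation κ θ 0 T ≤
      ENNReal.ofReal ((M₀ : ℝ) ^ 2 * ε ^ (2 * (β : ℝ))) + 2 * ((M : ℝ≥0∞) ^ 2 * ENNReal.ofReal (a₁ + a₂)) := by
    rw [h2D]
    refine setLIntegral_Ioo_le_of_ae_le hT ?_
    filter_upwards [hmain] with t ht
    rwa [h2D] at ht
  refine hfin.trans (le_of_eq ?_)
  have hM : ((M : ℝ≥0∞)) ^ 2 = ENNReal.ofReal ((M : ℝ) ^ 2) := by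
    rw [ENNReal.ofReal_pow (NNReal.coe_nonneg M), ENNReal.ofReal_coe_nnreal]
  rw [hM, ← ENNReal.ofReal_mul (sq_nonneg _), ← ENNReal.ofReal_ofNat, ← ENNReal.ofReal_mul zero_le_two,
    ← ENNReal.ofReal_add (by positivity) (by positivity)]
  congr 1
  rw [ha₁, ha₂]
  ring

/-! ## The theorem, time-integrated corner -/

/-- **The Obukhov–Corrsin threshold with the time pairing `(p,p°) = (∞,2)`: `L^∞_t C^{0,α}`
velocities, `L²_t C^{0,β}` scalars, `C^{0,β}` data** (barrier audit 2026-08-17, gen 14; the corner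
of scope caveat (i) of `DrivasElgindiIyerJeong2022_thm4` that is asserted without proof in
[cite: ElgindiLiss2024, (1.4)], made a theorem). Let `T > 0`, `α ∈ (0,1]`, `β ∈ (0,1]`. For all
bounds `K, M₀, M` and `κ₀` there is a constant `C = C(d, α, β, K, M₀, M, κ₀)` — explicitly
`C = ½(M₀² c^{2β} κ₀^{(1-α)/(α+1)} + 4dC₁KM² c^{α+2β-1} + 2dC₁²M² c^{2β-2})`, `c = ¼κ₀^{-1/(α+1)}`,
`C₁ = Torus.gradProfileMass d`, independent of `T` — such that: whenever `u` is a velocity field of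
the weak-solution class with `‖u(t)‖_{C^{0,α}} ≤ K` for a.e. `t ∈ (0,T)`, `θ₀ ∈ C^{0,β}` with
`‖θ₀‖_{C^{0,β}} ≤ M₀`, `0 < κ ≤ κ₀`, and `θ` is a weak solution of `∂ₜθ + u·∇θ = κΔθ`, `θ(0) = θ₀`
on `T^d × [0,T)` obeying the energy balance, with `θ(t) ∈ C^{0,β}` for a.e. `t` and
`‖θ‖_{L²(0,T;C^{0,β})} ≤ M` (`eLpHolderNorm 2 β θ (Ioo 0 T) ≤ M`), then
`κ∫₀ᵀ‖∇θ(t)‖²_{L²} dt ≤ C κ^{(α+2β-1)/(α+1)}`. Hence no anomalous scalar dissipation for families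
with these three bounds when `β > (1-α)/2` (corollary below); the datum bound `M₀` cannot be
dropped at family level (module docstring: heat flows of `sin(2πN_jx₁)` with `κ_j = N_j^{2β-2}`),
and the flexible side at this corner is [cite: ElgindiLiss2024, Thm. 2] (`u ∈ C_tC^α_x`, all
smooth data, scalars bounded in `L²_tC^β`, any `β < (1-α)/2`, every `α ∈ (0,1)`).
[cite: DrivasEtAl2022, Thm. 4 and its proof] -/
theorem DrivasElgindiIyerJeong2022_thm4_timeIntegrated (d : Type) [Fintype d] [DecidableEq d]
    (T : ℝ) (hT : 0 < T) (α β : ℝ≥0) (hα : 0 < α ∧ α ≤ 1) (hβ : 0 < β ∧ β ≤ 1)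
    (K M₀ M κ₀ : ℝ≥0) :
    ∃ C : ℝ≥0,
      ∀ (u : ℝ → UnitAddTorus d → EuclideanSpace ℝ d)
        (_huK : ∀ᵐ t ∂(volume.restrict (Ioo 0 T)), eBoundedHolderNorm α (u t) ≤ K)
        (θ₀ : UnitAddTorus d → ℝ) (_hθ₀ : eBoundedHolderNorm β θ₀ ≤ M₀)
        (κ : ℝ) (_hκ : 0 < κ) (_hκ₀ : κ ≤ κ₀)
        (θ : ℝ → UnitAddTorus d → ℝ) (_hθ : Torus.IsWeakScalarTransportOn T κ u θ₀ θ)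
        (_henergy : ∀ᵐ t ∂(volume.restrict (Ioo 0 T)),
          (∫⁻ x, ‖θ t x‖ₑ ^ 2) + 2 * Torus.eScalarDissipation κ θ 0 t ≤ ∫⁻ x, ‖θ₀ x‖ₑ ^ 2)
        (_hθB : ∀ᵐ t ∂(volume.restrict (Ioo 0 T)), MemBoundedHolder β (θ t))
        (_hθM : eLpHolderNorm 2 β θ (Ioo 0 T) ≤ M),
        Torus.eScalarDissipation κ θ 0 T ≤
          ENNReal.ofReal (C * κ ^ (((α : ℝ) + 2 * β - 1) / (α + 1))) := by
  rcases eq_zero_or_pos κ₀ with hκ₀ | hκ₀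
  · refine ⟨0, ?_⟩
    intro u _ θ₀ _ κ hκ hκκ₀
    exact absurd (hκ.trans_le hκκ₀) (by simp [hκ₀])
  -- the scale `ε = c κ^γ`
  set γ : ℝ := ((α : ℝ) + 1)⁻¹ with hγ
  have hα1pos : (0 : ℝ) < α + 1 := by positivity
  have hγ0 : 0 ≤ γ := by positivity
  have hκ₀' : (0 : ℝ) < κ₀ := hκ₀
  set c : ℝ := 4⁻¹ * (κ₀ : ℝ) ^ (-γ) with hc
  have hc0 : 0 < c := by positivity
  set C₁ : ℝ := Torus.gradProfileMass d with hC₁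
  have hC₁0 : 0 ≤ C₁ := Torus.gradProfileMass_nonneg
  set Cr : ℝ := 2⁻¹ * ((M₀ : ℝ) ^ 2 * (c ^ (2 * (β : ℝ)) * (κ₀ : ℝ) ^ ((1 - (α : ℝ)) * γ)) +
      (2 * (2 * Fintype.card d * C₁ * (M : ℝ) ^ 2) * K) * c ^ ((α : ℝ) + 2 * β - 1) +
      (2 * (Fintype.card d * (C₁ ^ 2 * (M : ℝ) ^ 2))) * c ^ (2 * (β : ℝ) - 2)) with hCr
  have hCr0 : 0 ≤ Cr := by positivity
  refine ⟨Cr.toNNReal, ?_⟩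
  intro u huK θ₀ hθ₀ κ hκ hκκ₀ θ hθ henergy hθB hθM
  set ε : ℝ := c * κ ^ γ with hε_def
  have hε : 0 < ε := by positivity
  have hε' : ε ≤ 1 / 4 := by
    have h1 : κ ^ γ ≤ (κ₀ : ℝ) ^ γ := Real.rpow_le_rpow hκ.le (by exact_mod_cast hκκ₀) hγ0
    have h2 : (κ₀ : ℝ) ^ (-γ) * (κ₀ : ℝ) ^ γ = 1 := by
      rw [Real.rpow_neg hκ₀'.le, inv_mul_cancel₀ (Real.rpow_pos_of_pos hκ₀' γ).ne']
    calc ε = 4⁻¹ * ((κ₀ : ℝ) ^ (-γ) * κ ^ γ) := by rw [hε_def, hc, mul_assoc]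
      _ ≤ 4⁻¹ * ((κ₀ : ℝ) ^ (-γ) * (κ₀ : ℝ) ^ γ) := by gcongr
      _ = 1 / 4 := by rw [h2]; norm_num
  have hraw := two_mul_eScalarDissipation_le_timeIntegrated hT hβ.1 huK hθ₀ hκ hθ henergy hθB hθM hε hε'
  -- optimisation in `ℓ`
  have hscale := scale_bound (β := (β : ℝ)) (2 * (2 * Fintype.card d * C₁ * (M : ℝ) ^ 2) * K)
    (2 * (Fintype.card d * (C₁ ^ 2 * (M : ℝ) ^ 2))) (by exact_mod_cast hα.2) hα1pos hκ
    (by exact_mod_cast hκκ₀) hc0 hγ (sq_nonneg (M₀ : ℝ))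
  have hreal : (M₀ : ℝ) ^ 2 * ε ^ (2 * (β : ℝ)) +
      2 * ((2 * Fintype.card d * C₁ * (M : ℝ) ^ 2 * ε ^ ((α : ℝ) + 2 * β - 1)) * K +
        κ * (Fintype.card d * (C₁ ^ 2 * (M : ℝ) ^ 2 * ε ^ (2 * (β : ℝ) - 2)))) ≤
      2 * ((Cr.toNNReal : ℝ≥0) * κ ^ (((α : ℝ) + 2 * β - 1) / (α + 1))) := by
    rw [Real.coe_toNNReal _ hCr0, hCr]
    calc _ = (M₀ : ℝ) ^ 2 * (c * κ ^ γ) ^ (2 * (β : ℝ)) +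
          2 * (2 * Fintype.card d * C₁ * (M : ℝ) ^ 2) * K * (c * κ ^ γ) ^ ((α : ℝ) + 2 * β - 1) +
          2 * (Fintype.card d * (C₁ ^ 2 * (M : ℝ) ^ 2)) * (κ * (c * κ ^ γ) ^ (2 * (β : ℝ) - 2)) := by
          rw [hε_def]; ring
      _ ≤ _ := hscale
      _ = _ := by ring
  calc Torus.eScalarDissipation κ θ 0 T
      ≤ 2⁻¹ * (2 * Torus.eScalarDissipation κ θ 0 T) := by
        rw [← mul_assoc, ENNReal.inv_mul_cancel two_ne_zero ENNReal.ofNat_ne_top, one_mul]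
    _ ≤ 2⁻¹ * ENNReal.ofReal (2 * ((Cr.toNNReal : ℝ≥0) * κ ^ (((α : ℝ) + 2 * β - 1) / (α + 1)))) := by
        gcongr
        exact hraw.trans (ENNReal.ofReal_le_ofReal hreal)
    _ = ENNReal.ofReal ((Cr.toNNReal : ℝ≥0) * κ ^ (((α : ℝ) + 2 * β - 1) / (α + 1))) := by
        rw [ENNReal.ofReal_mul zero_le_two, ENNReal.ofReal_ofNat, ← mul_assoc,
          ENNReal.inv_mul_cancel two_ne_zero ENNReal.ofNat_ne_top, one_mul]

/-- **No anomalous scalar dissipation above the Obukhov–Corrsin line with time-mean-square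
Hölder bounds on the scalars** (barrier audit 2026-08-17, gen 14; family form of
`DrivasElgindiIyerJeong2022_thm4_timeIntegrated`). Let `α + 2β > 1`, `κ_j > 0` with `κ_j → 0`,
and for each `j` let `u_j` be a field of the weak-solution class with `‖u_j(t)‖_{C^{0,α}} ≤ K`
for a.e. `t ∈ (0,T)`, data with `‖θ₀,ⱼ‖_{C^{0,β}} ≤ M₀`, and weak solutions `θ_j` of
`∂ₜθ + u_j·∇θ = κ_jΔθ` obeying the energy balance with `θ_j(t) ∈ C^{0,β}` for a.e. `t` and
`‖θ_j‖_{L²(0,T;C^{0,β})} ≤ M` — time-INTEGRATED, so that `‖θ_j(t)‖_{C^{0,β}}` may blow up on small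
sets of times along the family. Then `κ_j∫₀ᵀ‖∇θ_j‖²_{L²} → 0`. On the hypotheses: the datum
bound `M₀` cannot be dropped (module docstring: heat flows of rough data, `u_j ≡ 0`); the
threshold `α + 2β > 1` is sharp at this corner for every `α ∈ (0,1)` [cite: ElgindiLiss2024, Thm. 2];
and the velocity bound is in `L^∞_t`, not `L¹_t` — against merely `L¹_tC^α` fields
time-integrated scalar bounds control nothing (scope caveat (i) of the barrier: the time pairing
`∫₀ᵀ[u]_α[θ]²_β dt`). [cite: DrivasEtAl2022, Thm. 4] -/
theorem DrivasElgindiIyerJeong2022_thm4_timeIntegrated.noAnomalousScalarDissipation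
    (d : Type) [Fintype d] [DecidableEq d] (T : ℝ)
    (hT : 0 < T) (α β : ℝ≥0) (hα : 0 < α ∧ α ≤ 1) (hβ : 0 < β ∧ β ≤ 1)
    (hOC : 1 < (α : ℝ) + 2 * β) (K M₀ M : ℝ≥0)
    (u : ℕ → ℝ → UnitAddTorus d → EuclideanSpace ℝ d)
    (huK : ∀ j, ∀ᵐ t ∂(volume.restrict (Ioo 0 T)), eBoundedHolderNorm α (u j t) ≤ K)
    (θ₀ : ℕ → UnitAddTorus d → ℝ) (hθ₀ : ∀ j, eBoundedHolderNorm β (θ₀ j) ≤ M₀)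
    (κ : ℕ → ℝ) (hκ : ∀ j, 0 < κ j) (hκ₀ : Tendsto κ atTop (𝓝 0))
    (θ : ℕ → ℝ → UnitAddTorus d → ℝ)
    (hθ : ∀ j, Torus.IsWeakScalarTransportOn T (κ j) (u j) (θ₀ j) (θ j))
    (henergy : ∀ j, ∀ᵐ t ∂(volume.restrict (Ioo 0 T)),
      (∫⁻ x, ‖θ j t x‖ₑ ^ 2) + 2 * Torus.eScalarDissipation (κ j) (θ j) 0 t ≤ ∫⁻ x, ‖θ₀ j x‖ₑ ^ 2)
    (hθB : ∀ j, ∀ᵐ t ∂(volume.restrict (Ioo 0 T)), MemBoundedHolder β (θ j t))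
    (hθM : ∀ j, eLpHolderNorm 2 β (θ j) (Ioo 0 T) ≤ M) :
    Tendsto (fun j => Torus.eScalarDissipation (κ j) (θ j) 0 T) atTop (𝓝 0) := by
  obtain ⟨C, hC⟩ := DrivasElgindiIyerJeong2022_thm4_timeIntegrated d T hT α β hα hβ K M₀ M 1
  have hexp : 0 < ((α : ℝ) + 2 * β - 1) / (α + 1) := by
    have : (0 : ℝ) < α + 1 := by positivity
    exact div_pos (by linarith) this
  have hpow : Tendsto (fun j => κ j ^ (((α : ℝ) + 2 * β - 1) / (α + 1))) atTop (𝓝 0) :=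
    hκ₀.rpow_const_nhds_zero hexp
  have hup : Tendsto (fun j => ENNReal.ofReal (C * κ j ^ (((α : ℝ) + 2 * β - 1) / (α + 1))))
      atTop (𝓝 0) := by
    have := (hpow.const_mul (C : ℝ))
    simp only [mul_zero] at this
    simpa using ENNReal.tendsto_ofReal this
  have hev : ∀ᶠ j in atTop, κ j ≤ 1 :=
    (hκ₀.eventually (Iic_mem_nhds one_pos)).mono fun j hj => hj
  refine tendsto_of_tendsto_of_tendsto_of_le_of_le' tendsto_const_nhds hup
    (Eventually.of_forall fun _ => bot_le) (hev.mono fun j hj => ?_)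
  exact hC (u j) (huK j) (θ₀ j) (hθ₀ j) (κ j) (hκ j) (by exact_mod_cast hj) (θ j) (hθ j)
    (henergy j) (hθB j) (hθM j)

end Literature.Barriers.AnomalousDissipation

end
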